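import Summits.RiemannHypothesis.RiemannHypothesis.Theorems.PfPersistenceAdmissibleClass

/-!
# F6 — NESTED WINDOWS: Rayleigh floors transfer from `N` to every `N' ≤ N` (pub-rhpf FAKE SEAT 6; GAP row F6-G1 (b)).
mechanism/rigidity campaign; no RH claims.

KERNEL content (all PROVED, no sorry):
* `sum_extend_mul`        — bookkeeping: a sum against the zero-extension of `u` along an injection `f` is the pulled-back sum.
* `rayleigh_floor_submatrix` — for ANY real square matrix `M`, injection `f` and real `ε`: if `ε‖v‖² ≤ vᵀMv` for all `v`, then
                             `ε‖u‖² ≤ uᵀ(M.submatrix f f)u` for all `u` (Rayleigh–Ritz / compression monotonicity of the bottom of the spectrum).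
* `evenBlock_castLE`      — the even Galerkin block of ANY weight table at `(a, N')` is the leading principal submatrix of the block at `(a, N)`,
                             `N' ≤ N` (the entries `W(θ_{ξ_n ξ_m})` do not depend on the truncation rank).
* `galerkin_floor_mono`   — hence every Rayleigh floor of the `(a, N)` block is a floor of the `(a, N')` block: `λ_min(a, N) ≤ λ_min(a, N')` for every
                             weight table (ζ, every fake, every control), and
* `windowNegative_mono`   — a negative direction at `(a, N')` zero-extends to one at `(a, N)`.

CONSEQUENCE recorded in HOME/GAP-CLASSES.md F6-G1 (b): for the served companion pair `(N, N−20)` the ORDER of `|ε₁⁺(N)|, |ε₁⁺(N−20)|` is determined by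
the common SIGN (both positive ⇒ `ε₁⁺(N) ≤ ε₁⁺(N−20)`; both negative ⇒ `|ε₁⁺(N)| ≥ |ε₁⁺(N−20)|`), so a reader of that bit (or of the side of 1 of
`eps1_ratio_Nminus`) restates `sgn ε₁⁺` at the window — an R1 reader, never closable by an `ε₁ ≤ 0` fake and never a separation to be booked against F6.
-/

set_option linter.dupNamespace false  -- the mandated namespace repeats `RiemannHypothesis`

noncomputable section

open Matrix Finset

namespace Summit.RiemannHypothesis.RiemannHypothesis.Theorems.PfPersistence.F6

variable {m n : ℕ}

/-- PROVED (bookkeeping): summing `X` against the zero-extension of `u` along an injection `f` pulls the sum back along `f`. -/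
theorem sum_extend_mul (f : Fin m → Fin n) (hf : Function.Injective f) (u : Fin m → ℝ) (X : Fin n → ℝ) :
    ∑ j, Function.extend f u 0 j * X j = ∑ i, u i * X (f i) := by
  classical
  have h1 : ∑ j ∈ (Finset.univ : Finset (Fin m)).image f, Function.extend f u 0 j * X j
      = ∑ j, Function.extend f u 0 j * X j := by
    apply Finset.sum_subset (Finset.subset_univ _)
    intro j _ hj
    have hne : ¬ ∃ i, f i = j := by
      rintro ⟨i, rfl⟩
      exact hj (Finset.mem_image_of_mem f (Finset.mem_univ i))
    rw [Function.extend_apply' _ _ _ hne]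
    simp
  rw [← h1, Finset.sum_image (fun i _ k _ hik => hf hik)]
  simp [hf.extend_apply]

/-- PROVED (Rayleigh–Ritz for compressions): a Rayleigh floor of `M` is a Rayleigh floor of every principal compression
`M.submatrix f f` along an injection `f` (test the floor on the zero-extension of `u`). -/
theorem rayleigh_floor_submatrix (M : Matrix (Fin n) (Fin n) ℝ) (f : Fin m → Fin n) (hf : Function.Injective f)
    (ε : ℝ) (h : ∀ v : Fin n → ℝ, ε * (v ⬝ᵥ v) ≤ v ⬝ᵥ (M *ᵥ v)) (u : Fin m → ℝ) :
    ε * (u ⬝ᵥ u) ≤ u ⬝ᵥ (M.submatrix f f *ᵥ u) := by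
  classical
  set v : Fin n → ℝ := Function.extend f u 0 with hv
  have hvv : v ⬝ᵥ v = u ⬝ᵥ u := by
    simp only [dotProduct]
    rw [sum_extend_mul f hf u v]
    simp [hv, hf.extend_apply]
  have inner : ∀ j, (∑ l, M j l * v l) = ∑ k, M j (f k) * u k := by
    intro j
    have h2 := sum_extend_mul f hf u (fun l => M j l)
    calc (∑ l, M j l * v l) = ∑ l, v l * M j l := by
            refine Finset.sum_congr rfl ?_; intro l _; ring
      _ = ∑ k, u k * M j (f k) := h2
      _ = ∑ k, M j (f k) * u k := by
            refine Finset.sum_congr rfl ?_; intro k _; ring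
  have hMv : v ⬝ᵥ (M *ᵥ v) = u ⬝ᵥ (M.submatrix f f *ᵥ u) := by
    simp only [dotProduct, mulVec, Matrix.submatrix_apply]
    have h3 := sum_extend_mul f hf u (fun j => ∑ l, M j l * v l)
    calc (∑ j, v j * ∑ l, M j l * v l) = ∑ i, u i * ∑ l, M (f i) l * v l := h3
      _ = ∑ i, u i * ∑ k, M (f i) (f k) * u k := by
            refine Finset.sum_congr rfl ?_; intro i _; rw [inner (f i)]
  calc ε * (u ⬝ᵥ u) = ε * (v ⬝ᵥ v) := by rw [hvv]
    _ ≤ v ⬝ᵥ (M *ᵥ v) := h v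
    _ = u ⬝ᵥ (M.submatrix f f *ᵥ u) := hMv

/-- PROVED: NESTED GALERKIN WINDOWS — at fixed half-length `a` the even block of any weight table at rank `N'` is the leading
principal submatrix of the block at rank `N ≥ N'` (entries `W(θ_{ξ_n, ξ_m})` are rank-independent). -/
theorem evenBlock_castLE (w : Weights) {a : ℝ} (ha : 0 < a) {N' N : ℕ} (h : N' ≤ N) :
    evenBlock w ⟨a, N', ha⟩ =
      (evenBlock w ⟨a, N, ha⟩).submatrix (Fin.castLE (Nat.succ_le_succ h)) (Fin.castLE (Nat.succ_le_succ h)) := by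
  ext i j
  simp [evenBlock, Matrix.submatrix_apply]

/-- PROVED (ORDER BIT, floor form): every Rayleigh floor `ε` of the `(a, N)` block is a Rayleigh floor of the `(a, N')` block for
`N' ≤ N` — i.e. `λ_min(a, N) ≤ λ_min(a, N')` for EVERY weight table. With both signs equal this fixes the order of the moduli:
both positive ⇒ `|ε₁(N)| ≤ |ε₁(N')|`, both negative ⇒ `|ε₁(N)| ≥ |ε₁(N')|`. -/
theorem galerkin_floor_mono (w : Weights) {a : ℝ} (ha : 0 < a) {N' N : ℕ} (h : N' ≤ N) (ε : ℝ)
    (hfloor : ∀ v : Fin (N + 1) → ℝ, ε * (v ⬝ᵥ v) ≤ v ⬝ᵥ (evenBlock w ⟨a, N, ha⟩ *ᵥ v)) :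
    ∀ u : Fin (N' + 1) → ℝ, ε * (u ⬝ᵥ u) ≤ u ⬝ᵥ (evenBlock w ⟨a, N', ha⟩ *ᵥ u) := by
  intro u
  rw [evenBlock_castLE w ha h]
  exact rayleigh_floor_submatrix _ _ (Fin.castLE_injective _) ε hfloor u

/-- PROVED: negativity is MONOTONE UP the N-ladder — a negative direction of the `(a, N')` block zero-extends to one of the
`(a, N)` block, `N' ≤ N` (contrapositive of `galerkin_floor_mono` at `ε = 0`). -/
theorem windowNegative_mono (w : Weights) {a : ℝ} (ha : 0 < a) {N' N : ℕ} (h : N' ≤ N)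
    (hneg : ∃ u : Fin (N' + 1) → ℝ, u ⬝ᵥ (evenBlock w ⟨a, N', ha⟩ *ᵥ u) < 0) :
    ∃ v : Fin (N + 1) → ℝ, v ⬝ᵥ (evenBlock w ⟨a, N, ha⟩ *ᵥ v) < 0 := by
  by_contra hcon
  simp only [not_exists, not_lt] at hcon
  obtain ⟨u, hu⟩ := hneg
  have h0 := galerkin_floor_mono w ha h 0 (fun v => by simpa using hcon v) u
  simp at h0
  exact absurd hu (not_lt.mpr h0)

/-- PROVED: positivity is MONOTONE DOWN the N-ladder (`WindowPositive` at `(a, N)` ⇒ at every `(a, N')`, `N' ≤ N`). -/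
theorem windowPositive_anti (w : Weights) {a : ℝ} (ha : 0 < a) {N' N : ℕ} (h : N' ≤ N)
    (hpos : WindowPositive (evenBlock w ⟨a, N, ha⟩)) : WindowPositive (evenBlock w ⟨a, N', ha⟩) := by
  intro u
  have h0 := galerkin_floor_mono w ha h 0 (fun v => by simpa using hpos v) u
  simpa using h0

end Summit.RiemannHypothesis.RiemannHypothesis.Theorems.PfPersistence.F6

end
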